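import Literature.Algebra.EuclideanLattices.RegevRoutineQuantum
import HarnessLib

/-!
# Regev's per-copy routine as a circuit family, V: data words, the semantic interface and the final state

Fifth file of the circuit-level construction towards the discharge of
`Literature.Algebra.EuclideanLattices.usvp_of_dihedralCoset` (O. Regev, *Quantum computation and
lattice problems*, SIAM J. Comput. 33 (2004), Thm. 1.1; the routine of the proof of Lemma 3.12,
p. 14). The classical semantics (`RegevRoutineSemantics.lean`) describes the final wire assignment
of the reversible program through the block functions `fW`, `fV` applied to data words read off
zone-wise states. Here these words are made explicit, the one property of the block functions that
the routine relies on is isolated as a **semantic interface**, and under it the final state is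
computed in closed form and transported to the branches of the Hadamard layer of the compiled
circuit (`RegevRoutineQuantum.lean`):

* `window_add`, `window_congr`, `unaryU`; **`dW_eq`** — `dW s = U ++ ix ++ U ++ ta ++ x ++ g ++ Z`
  (`U = 1^L 0`, zones as `List.ofFn`, the counter zone as `[t < zc]`); **`dV_eq`** —
  `dV s = U ++ ta ++ x ++ g ++ Z ++ 0^{NNW − n0W} ++ (result wires of W)`; `eV_stV_eq_getElem` —
  the erase bit of cell `j` is letter `j` of `fV (dV s)`;
* `iterSt_cz_of_le`, `iterSt_succ_ix`, `iterSt_succ_ta` — the coins of zone `k` are untouched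
  before body `k`; the `ix`/`ta` zones entering body `k + 1`;
* `wordW`, `wordV` — the words the two blocks receive for register `k`, as functions of the input
  `x`, the guesses `g` and the coins `(ixc, tac)` of zone `k` (`dW_preW`, `dV_preW`);
* **`SemHyp`** — the semantic interface: a decidable liveness predicate `Act L x g k` and the one
  hypothesis that on `wordV` the second block function returns the `ix` coins followed by the
  erase mask of `ta` (nothing for a live register, the `ta` coins otherwise); consequences
  `ixBit_preW`, `maskBit_preW`, `iterSt_ix_eq`, `iterSt_ta_eq`, `finalSt_cz` (the `ix`, `ta` and
  coin zones end clean);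
* **`finSt`, `toWires_finalSt`** — the explicit final state: slot `k` holds the `ta` coins of zone
  `k` if register `k` is live and `0` otherwise, garbage zone `k` the read-out of `fW (wordW … k)`,
  mask-garbage zone `k` the `ta` coins of a dead register, the guesses stay, everything else is
  clean;
* `IsBranch`, `stateH_eq`, `isInput_liftW_of_isBranch`, **`liftW_kappa_of_isBranch`** — branches
  of the Hadamard layer are input assignments, and on them the compiled program computes
  `toWires finSt`.

No named fact is introduced.

## References

* O. Regev, *Quantum computation and lattice problems*, SIAM J. Comput. 33 (2004) 738–760, proof
  of Lemma 3.12 (p. 14: the routine; what remains in the registers after the measurement)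
  [Regev2004].
* C. H. Bennett, *Logical reversibility of computation*, IBM J. Res. Develop. 17 (1973), §2
  (compute, copy the result, uncompute) [Bennett1973].
* M. A. Nielsen, I. L. Chuang, *Quantum Computation and Quantum Information*, CUP 2010, §1.4.4,
  §3.2.5 [NielsenChuang2010].
-/

noncomputable section

namespace Literature.Algebra.EuclideanLattices

namespace RegevRoutine

open _root_.Computability Literature.Computability.Complexity Literature.Computability.Cryptography
  Literature.Computability.QuantumComplexity Literature.Computability.QuantumComplexity.ZoneGadgets
  Turing RevSim RevClean RevMux

variable {P : Params}

/-! ### Window words -/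

/-- Splitting a window. [folklore] -/
theorem window_add (w : ℕ → Bool) (S a b : ℕ) : window w S (a + b) = window w S a ++ window w (S + a) b := by
  unfold window
  rw [List.ofFn_add]
  congr 1
  congr 1
  funext j
  simp [Nat.add_assoc]

/-- A window is determined by the values on it. [folklore] -/
theorem window_congr {w : ℕ → Bool} {S len : ℕ} {f : Fin len → Bool} (h : ∀ j : Fin len, w (S + j) = f j) :
    window w S len = List.ofFn f := by
  unfold window; congr 1; funext j; exact h j

/-- The unary marker word `1^L 0`. [folklore] -/
def unaryU (L : ℕ) : List Bool := List.replicate L true ++ [false]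

/-- `1^L 0` as `ofFn`. [folklore] -/
theorem unaryU_eq_ofFn (L : ℕ) : unaryU L = List.ofFn fun j : Fin (L + 1) => decide ((j : ℕ) < L) := by
  apply List.ext_getElem
  · simp [unaryU]
  · intro i h1 h2
    simp only [unaryU, List.getElem_ofFn]
    by_cases hi : i < L
    · rw [List.getElem_append_left (by simpa using hi)]
      simp [hi]
    · have hiL : i = L := by simp [unaryU] at h1; omega
      subst hiL
      rw [List.getElem_append_right (by simp)]
      simp

/-! ### The data word of `W` -/

section WordW

variable {L n : ℕ}

/-- **The data word of `W`, explicitly**: `U ++ ix ++ U ++ ta ++ x ++ g ++ Z`. [cite: Regev2004, Lemma 3.12 (proof, p. 14: the data of the routine)] -/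
theorem dW_eq (hn : n ≤ L) (s : St) :
    dW P L n s = unaryU L ++ List.ofFn (fun t : Fin (kap P L) => s.ix t) ++ unaryU L ++
      List.ofFn (fun t : Fin (sig L) => s.ta t) ++ List.ofFn (fun t : Fin L => s.x.getD t false) ++
      List.ofFn (fun t : Fin (gam P L) => s.g t) ++ List.ofFn (fun t : Fin (zet P L) => decide ((t : ℕ) < s.zc)) := by
  have hc := offsets_chain (P := P) L
  unfold dW n0W
  rw [window_add, window_add, window_add, window_add, window_add, window_add]
  rw [unaryU_eq_ofFn]
  congr 1
  congr 1
  congr 1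
  congr 1
  congr 1
  congr 1
  · exact window_congr fun j => by
      rw [toWires_U s hn (by omega) (by have := j.isLt; omega)]
      congr 1; have := j.isLt; simp only [eq_iff_iff]; constructor <;> intro h <;> omega
  · exact window_congr fun j => by
      rw [toWires_ix s hn (by omega) (by have := j.isLt; omega)]; congr 1; omega
  · exact window_congr fun j => by
      rw [toWires_U2 s hn (by omega) (by have := j.isLt; omega)]
      congr 1; have := j.isLt; simp only [eq_iff_iff]; constructor <;> intro h <;> omega
  · exact window_congr fun j => by
      rw [toWires_ta s hn (by omega) (by have := j.isLt; omega)]; congr 1; omega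
  · exact window_congr fun j => by
      rw [toWires_wz s hn (by omega) (by have := j.isLt; omega)]; congr 1; omega
  · exact window_congr fun j => by
      rw [toWires_gz0 s hn (by omega) (by have := j.isLt; omega)]; congr 1; omega
  · exact window_congr fun j => by
      rw [toWires_Z s hn (by omega) (by have := j.isLt; omega)]
      congr 1; have := j.isLt; simp only [eq_iff_iff]; constructor <;> intro h <;> omega

end WordW

/-! ### The data word of `V` and the erase bits -/

section WordV

variable {L n : ℕ}

/-- The data length of `V`, as a sum of zone sizes. [folklore] -/
theorem n0V_eq (L : ℕ) : n0V P L = (L + 1) + sig L + L + gam P L + zet P L + (NNW P L - n0W P L) + copyW P L := by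
  have hc := offsets_chain (P := P) L
  omega

/-- **The data word of `V`, explicitly**: `U ++ ta ++ x ++ g ++ Z ++ (work wires of W) ++ (result wires of W)`.
[cite: Bennett1973, §2 (the data from which the erased value is recomputed)] -/
theorem dV_eq (hn : n ≤ L) (s : St) :
    dV P L n s = unaryU L ++ List.ofFn (fun t : Fin (sig L) => s.ta t) ++ List.ofFn (fun t : Fin L => s.x.getD t false) ++
      List.ofFn (fun t : Fin (gam P L) => s.g t) ++ List.ofFn (fun t : Fin (zet P L) => decide ((t : ℕ) < s.zc)) ++
      List.ofFn (fun t : Fin (NNW P L - n0W P L) => s.wwork t) ++ List.ofFn (fun t : Fin (copyW P L) => s.wres t) := by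
  have hc := offsets_chain (P := P) L
  unfold dV
  rw [n0V_eq, window_add, window_add, window_add, window_add, window_add, window_add, unaryU_eq_ofFn]
  congr 1
  congr 1
  congr 1
  congr 1
  congr 1
  congr 1
  · exact window_congr fun j => by
      rw [toWires_U2 s hn (by omega) (by have := j.isLt; omega)]
      congr 1; have := j.isLt; simp only [eq_iff_iff]; constructor <;> intro h <;> omega
  · exact window_congr fun j => by
      rw [toWires_ta s hn (by omega) (by have := j.isLt; omega)]; congr 1; omega
  · exact window_congr fun j => by
      rw [toWires_wz s hn (by omega) (by have := j.isLt; omega)]; congr 1; omega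
  · exact window_congr fun j => by
      rw [toWires_gz0 s hn (by omega) (by have := j.isLt; omega)]; congr 1; omega
  · exact window_congr fun j => by
      rw [toWires_Z s hn (by omega) (by have := j.isLt; omega)]
      congr 1; have := j.isLt; simp only [eq_iff_iff]; constructor <;> intro h <;> omega
  · exact window_congr fun j => by
      rw [toWires_wwork s hn (by omega) (by have := j.isLt; omega)]; congr 1; omega
  · exact window_congr fun j => by
      rw [toWires_wres s hn (by omega) (by have := j.isLt; omega)]; congr 1; omega

/-- The output of `V` is shorter than its number of read-out cells. [folklore] -/
theorem length_fV_lt_JJ (s : St) : (P.fV (dV P L n s)).length < JJ P.eV P.MV (n0V P L) := by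
  have hlen : (dV P L n s).length = n0V P L := length_window _ _ _
  have hM := P.hMV (dV P L n s)
  rw [hlen] at hM
  exact (length_lt_JJ_of_outputsWithin hlen hM).1

/-- **The erase bit of cell `j` is letter `j` of the output of `V`** (read in the state after the
first copy of `V`, for cells inside the output word). [cite: NielsenChuang2010, §3.2.5 (copying the plain output bits)] -/
theorem eV_stV_eq_getElem (hn : n ≤ L) (s : St) {j : ℕ} (hj : j < (P.fV (dV P L n s)).length) :
    eV P L n (stV P L n s) j = (P.fV (dV P L n s))[j] := by
  have hJJ : j < JJ P.eV P.MV (n0V P L) := hj.trans (length_fV_lt_JJ s)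
  rw [eV_eq hn, tV_eq P hJJ]
  change rdV P L n s _ = _
  unfold rdV
  have e1 : NNV P L + (oV P L + resW P.eV P.MV (n0V P L) j (CWrap.symTrue P.MV) - (oV P L + NNV P L)) =
      resW P.eV P.MV (n0V P L) j (CWrap.symTrue P.MV) := by
    have := NN_le_resW (e := P.eV) (M := P.MV) (n0V P L) j (CWrap.symTrue P.MV)
    unfold NNV; omega
  rw [e1, readOut_resW hJJ]
  have hlen : (dV P L n s).length = n0V P L := length_window _ _ _
  have hM := P.hMV (dV P L n s)
  rw [hlen] at hM
  exact CWrap.outBit_symTrue_eq hlen hM hj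

end WordV

/-! ### The pre-state of a register: its coins are untouched until its body runs -/

section PreState

variable {L n : ℕ}

/-- Bodies `0 … k−1` do not touch coin zone `j ≥ k`. [folklore] -/
theorem iterSt_cz_of_le (s : St) : ∀ k j, k ≤ j → (iterSt P L n k s).cz j = s.cz j
  | 0, _, _ => rfl
  | k + 1, j, hkj => by
    funext t
    change (bodySt P L n k (iterSt P L n k s)).cz j t = s.cz j t
    rw [bodySt_cz, if_neg (fun h => absurd h.1 (by omega)), if_neg (fun h => absurd h.1 (by omega)),
      congrFun (iterSt_cz_of_le s k j (by omega)) t]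

/-- The `ix` zone before body `k + 1` is the `ix` output of body `k`. [folklore] -/
theorem iterSt_succ_ix (s : St) (k : ℕ) :
    (iterSt P L n (k + 1) s).ix = fun t => (iterSt P L n k s).cz k t ^^ ixBit P L n k (iterSt P L n k s) t :=
  bodySt_ix k _

/-- The `ta` zone before body `k + 1` is the `ta` output of body `k`. [folklore] -/
theorem iterSt_succ_ta (s : St) (h : Inv n 0 s) (k : ℕ) :
    (iterSt P L n (k + 1) s).ta = fun t => if t < slotW n then false else
      ((iterSt P L n k s).cz k (kap P L + t) ^^ maskBit P L n k (iterSt P L n k s) t) := by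
  change (bodySt P L n k (iterSt P L n k s)).ta = _
  rw [bodySt_ta]
  funext t
  by_cases ht : t < slotW n
  · rw [if_pos ht, if_pos ht, (inv_iterSt h k).slot k le_rfl]
  · rw [if_neg ht, if_neg ht, (inv_iterSt h k).tm]
    simp

end PreState

/-! ### The semantic interface of the block functions -/

section Interface

/-- The unary counter word before body `k`: `1^k 0^{zet − k}`. [folklore] -/
def counterWord (P : Params) (L k : ℕ) : List Bool := List.ofFn fun t : Fin (zet P L) => decide ((t : ℕ) < k)

/-- **The data word that `W` receives for register `k`**, as a function of the input, the guesses
and the coins of zone `k`. [cite: Regev2004, Lemma 3.12 (proof, p. 14)] -/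
def wordW (P : Params) (L : ℕ) (x : List Bool) (g ixc tac : ℕ → Bool) (k : ℕ) : List Bool :=
  unaryU L ++ List.ofFn (fun t : Fin (kap P L) => ixc t) ++ unaryU L ++ List.ofFn (fun t : Fin (sig L) => tac t) ++
    List.ofFn (fun t : Fin L => x.getD t false) ++ List.ofFn (fun t : Fin (gam P L) => g t) ++ counterWord P L k

/-- **The data word that `V` receives for register `k`**: the same data without `ix`, the clean work
wires of `W`, and the result wires of `W` holding the read-out of `fW` on `wordW`.
[cite: Bennett1973, §2] -/
def wordV (P : Params) (L : ℕ) (x : List Bool) (g ixc tac : ℕ → Bool) (k : ℕ) : List Bool :=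
  unaryU L ++ List.ofFn (fun t : Fin (sig L) => tac t) ++ List.ofFn (fun t : Fin L => x.getD t false) ++
    List.ofFn (fun t : Fin (gam P L) => g t) ++ counterWord P L k ++ List.ofFn (fun _ : Fin (NNW P L - n0W P L) => false) ++
    List.ofFn (fun t : Fin (copyW P L) => readOut P.eW P.MW (n0W P L) (P.fW (wordW P L x g ixc tac k)) (NNW P L + t))

/-- **The semantic interface of the block functions.** `Act L x g k` says that register `k` is
prepared as a live register (a decidable predicate of the input, the guesses and `k`); the one
hypothesis `hv` says that on the word it receives for register `k`, the second block function
returns the `ix` coins followed by the erase mask of `ta` — nothing for a live register, the `ta`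
coins themselves otherwise. Concrete block functions discharge it by parsing. [cite: Regev2004, Lemma 3.12 (proof, p. 14: what remains in the register after the measurement)] -/
structure SemHyp (P : Params) where
  /-- liveness of register `k` -/
  Act : ℕ → List Bool → (ℕ → Bool) → ℕ → Prop
  /-- decidability of liveness -/
  dec : ∀ L x g k, Decidable (Act L x g k)
  /-- the output of the second block function -/
  hv : ∀ (L : ℕ) (x : List Bool) (g ixc tac : ℕ → Bool) (k : ℕ), x.length = L → k < rmax P L →
    P.fV (wordV P L x g ixc tac k) = List.ofFn (fun t : Fin (kap P L) => ixc t) ++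
      (if Act L x g k then List.replicate (sig L) false else List.ofFn (fun t : Fin (sig L) => tac t))

/-- Liveness is decidable. [folklore] -/
instance SemHyp.instDecidableAct (S : SemHyp P) (L : ℕ) (x : List Bool) (g : ℕ → Bool) (k : ℕ) : Decidable (S.Act L x g k) :=
  S.dec L x g k

end Interface

/-! ### The words met by the routine -/

section RoutineWords

variable {L n : ℕ} {x : List Bool} {w : ℕ → Bool}

/-- The guesses of an input assignment. [folklore] -/
def guessOf (P : Params) (L : ℕ) (w : ℕ → Bool) : ℕ → Bool := fun t => w (oGz P L + t)
/-- The `ix` coins of zone `k` of an input assignment. [folklore] -/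
def ixcOf (P : Params) (L : ℕ) (w : ℕ → Bool) (k : ℕ) : ℕ → Bool := fun t => w (oC P L k + t)
/-- The `ta` coins of zone `k` of an input assignment. [folklore] -/
def tacOf (P : Params) (L : ℕ) (w : ℕ → Bool) (k : ℕ) : ℕ → Bool := fun t => w (oC P L k + (kap P L + t))

/-- Fields of the state after the two coin swaps. [folklore] -/
theorem st21_fields (k : ℕ) (s : St) :
    (st2 P L k (st1 P L k s)).ix = (fun t => s.cz k t) ∧ (st2 P L k (st1 P L k s)).ta = (fun t => s.cz k (kap P L + t)) ∧
      (st2 P L k (st1 P L k s)).x = s.x ∧ (st2 P L k (st1 P L k s)).g = s.g ∧ (st2 P L k (st1 P L k s)).zc = s.zc ∧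
      (st2 P L k (st1 P L k s)).wwork = s.wwork ∧ (st2 P L k (st1 P L k s)).wres = s.wres := by
  simp only [st2, st1, true_and, and_true]
  funext t
  rw [if_neg (by omega)]

/-- The state in which `W` runs for register `k`. [folklore] -/
abbrev preW (P : Params) (L n : ℕ) (x : List Bool) (w : ℕ → Bool) (k : ℕ) : St :=
  st2 P L k (st1 P L k (iterSt P L n k (initSt P L n x w)))

/-- **`W` receives `wordW` for register `k`.** [cite: Regev2004, Lemma 3.12 (proof, p. 14)] -/
theorem dW_preW (hn : n ≤ L) (k : ℕ) :
    dW P L n (preW P L n x w k) = wordW P L x (guessOf P L w) (ixcOf P L w k) (tacOf P L w k) k := by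
  have hinv := inv_iterSt (P := P) (L := L) (inv_initSt (P := P) L n x w) k
  obtain ⟨-, h2, h3, -⟩ := iterSt_const (P := P) (L := L) (n := n) (initSt P L n x w) k
  have hcz := iterSt_cz_of_le (P := P) (L := L) (n := n) (initSt P L n x w) k k le_rfl
  obtain ⟨f1, f2, f3, f4, f5, -, -⟩ := st21_fields (P := P) (L := L) k (iterSt P L n k (initSt P L n x w))
  rw [dW_eq hn, wordW, counterWord]
  simp only [f1, f2, f3, f4, f5, h2, h3, hinv.zc, hcz]
  rfl

/-- **`V` receives `wordV` for register `k`.** [cite: Bennett1973, §2] -/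
theorem dV_preW (hn : n ≤ L) (k : ℕ) :
    dV P L n (stW P L n (preW P L n x w k)) = wordV P L x (guessOf P L w) (ixcOf P L w k) (tacOf P L w k) k := by
  have hinv := inv_iterSt (P := P) (L := L) (inv_initSt (P := P) L n x w) k
  obtain ⟨-, h2, h3, -⟩ := iterSt_const (P := P) (L := L) (n := n) (initSt P L n x w) k
  have hcz := iterSt_cz_of_le (P := P) (L := L) (n := n) (initSt P L n x w) k k le_rfl
  obtain ⟨f1, f2, f3, f4, f5, f6, -⟩ := st21_fields (P := P) (L := L) k (iterSt P L n k (initSt P L n x w))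
  rw [dV_eq hn, wordV, counterWord, ← dW_preW hn k]
  simp only [stW, rdW, f2, f3, f4, f5, f6, h2, h3, hinv.zc, hcz, hinv.clean.wwork]
  rfl

/-- **The erase bits of `ix` are the `ix` coins** (under the semantic interface). [folklore] -/
theorem ixBit_preW (S : SemHyp P) (hn : n ≤ L) (hx : x.length = L) {k : ℕ} (hk : k < rmax P L) {t : ℕ} (ht : t < kap P L) :
    ixBit P L n k (iterSt P L n k (initSt P L n x w)) t = ixcOf P L w k t := by
  have hv := S.hv L x (guessOf P L w) (ixcOf P L w k) (tacOf P L w k) k hx hk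
  have hlen : t < (P.fV (dV P L n (stW P L n (preW P L n x w k)))).length := by
    rw [dV_preW hn, hv]; simp; omega
  unfold ixBit
  rw [eV_stV_eq_getElem hn _ hlen]
  simp only [dV_preW hn, hv]
  rw [List.getElem_append_left (by simp; exact ht)]
  simp

/-- **The mask bits are the erase mask of `ta`**: nothing for a live register, the `ta` coins
otherwise (under the semantic interface). [folklore] -/
theorem maskBit_preW (S : SemHyp P) (hn : n ≤ L) (hx : x.length = L) {k : ℕ} (hk : k < rmax P L) {t : ℕ} (ht : t < sig L) :
    maskBit P L n k (iterSt P L n k (initSt P L n x w)) t =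
      if S.Act L x (guessOf P L w) k then false else tacOf P L w k t := by
  have hv := S.hv L x (guessOf P L w) (ixcOf P L w k) (tacOf P L w k) k hx hk
  have hlen : kap P L + t < (P.fV (dV P L n (stW P L n (preW P L n x w k)))).length := by
    rw [dV_preW hn, hv]; split_ifs <;> simp <;> omega
  unfold maskBit
  rw [show stEix P L n (stV P L n (stW P L n (preW P L n x w k))) = { stV P L n (stW P L n (preW P L n x w k)) with
      ix := fun t => (stV P L n (stW P L n (preW P L n x w k))).ix t ^^ eV P L n (stV P L n (stW P L n (preW P L n x w k))) t } from rfl]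
  rw [show eV P L n ({ stV P L n (stW P L n (preW P L n x w k)) with
      ix := fun t => (stV P L n (stW P L n (preW P L n x w k))).ix t ^^ eV P L n (stV P L n (stW P L n (preW P L n x w k))) t } : St)
      (kap P L + t) = eV P L n (stV P L n (stW P L n (preW P L n x w k))) (kap P L + t) from ?_]
  · rw [eV_stV_eq_getElem hn _ hlen]
    simp only [dV_preW hn, hv]
    rw [List.getElem_append_right (by simp)]
    split_ifs with ha
    · simp
    · simp
  · have hc := offsets_chain (P := P) L
    unfold eV
    exact toWires_eq_of _ _ (hix := fun _ hhi => by exfalso; have := (tV_bounds (P := P) L (kap P L + t)).1; omega)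

end RoutineWords

/-! ### The final state under the semantic interface -/

section Final

variable {L n : ℕ} {x : List Bool} {w : ℕ → Bool}

/-- A `ta`-field wire of zone `k` beyond the slot width is not a coin wire. [folklore] -/
theorem not_coinWire_ta_high {k t : ℕ} (hk : k < rmax P L) (h1 : slotW n ≤ t) (h2 : t < sig L) :
    ¬ CoinWire P L n (oC P L k + (kap P L + t)) := by
  have hc := offsets_chain (P := P) L
  have hcw : cW P L = kap P L + sig L := rfl
  have hC := oC_add_cW_le (P := P) hk
  rintro (⟨k', hk', h3, h4⟩ | ⟨h3, h4⟩)
  · rcases lt_trichotomy k k' with hlt | rfl | hgt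
    · have := oC_add_cW_le_oC (P := P) (L := L) hlt; omega
    · omega
    · have := oC_add_cW_le_oC (P := P) (L := L) hgt; omega
  · have := cBase_le_oC (P := P) L k; omega

/-- The `ta` coins of zone `k` vanish beyond the slot width (input assignments). [folklore] -/
theorem tacOf_high (hw : IsInput P L n x w) {k t : ℕ} (hk : k < rmax P L) (h1 : slotW n ≤ t) (h2 : t < sig L) :
    tacOf P L w k t = false := by
  have hc := offsets_chain (P := P) L
  have := cBase_le_oC (P := P) L k
  exact hw.zero _ (by omega) (not_coinWire_ta_high hk h1 h2)

/-- Later bodies do not change coin zone `j < k`. [folklore] -/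
theorem iterSt_cz_stable (s : St) {j : ℕ} : ∀ k, j < k → (iterSt P L n k s).cz j = (iterSt P L n (j + 1) s).cz j
  | 0, hk => absurd hk (Nat.not_lt_zero _)
  | k + 1, hk => by
    by_cases hjk : j = k
    · subst hjk; rfl
    · have hlt : j < k := by omega
      rw [← iterSt_cz_stable s k hlt]
      funext t
      change (bodySt P L n k (iterSt P L n k s)).cz j t = _
      rw [bodySt_cz, if_neg (fun h => hjk h.1), if_neg (fun h => hjk h.1)]

/-- **The `ix` zone is clean before every body** (it starts clean, and each body leaves the `ix`
coins XOR themselves). [folklore] -/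
theorem iterSt_ix_eq (S : SemHyp P) (hn : n ≤ L) (hx : x.length = L) : ∀ k, k ≤ rmax P L → ∀ t, t < kap P L →
    (iterSt P L n k (initSt P L n x w)).ix t = false
  | 0, _, _, _ => rfl
  | k + 1, hk, t, ht => by
    rw [iterSt_succ_ix]
    dsimp only
    rw [ixBit_preW S hn hx (by omega) ht, iterSt_cz_of_le _ k k le_rfl]
    change (ixcOf P L w k t ^^ ixcOf P L w k t) = false
    simp

/-- **The `ta` zone is clean before every body.** [folklore] -/
theorem iterSt_ta_eq (S : SemHyp P) (hn : n ≤ L) (hx : x.length = L) (hw : IsInput P L n x w) : ∀ k, k ≤ rmax P L → ∀ t, t < sig L →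
    (iterSt P L n k (initSt P L n x w)).ta t = false
  | 0, _, _, _ => rfl
  | k + 1, hk, t, ht => by
    rw [iterSt_succ_ta _ (inv_initSt L n x w)]
    dsimp only
    by_cases h1 : t < slotW n
    · rw [if_pos h1]
    · rw [if_neg h1, maskBit_preW S hn hx (by omega) ht, iterSt_cz_of_le _ k k le_rfl]
      change (tacOf P L w k t ^^ (if S.Act L x (guessOf P L w) k then false else tacOf P L w k t)) = false
      rw [tacOf_high hw (by omega) (not_lt.1 h1) ht]
      split_ifs <;> rfl

/-- **The coin zones end clean** (on the wires that are read). [folklore] -/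
theorem finalSt_cz (S : SemHyp P) (hn : n ≤ L) (hx : x.length = L) (hw : IsInput P L n x w) {k : ℕ} (hk : k < rmax P L) {t : ℕ} (ht : t < cW P L) :
    (iterSt P L n (rmax P L) (initSt P L n x w)).cz k t = false := by
  have hcw : cW P L = kap P L + sig L := rfl
  rw [congrFun (iterSt_cz_stable (initSt P L n x w) (rmax P L) hk) t]
  change (bodySt P L n k (iterSt P L n k (initSt P L n x w))).cz k t = false
  rw [bodySt_cz]
  by_cases h1 : t < kap P L
  · rw [if_pos ⟨rfl, h1⟩]
    exact iterSt_ix_eq S hn hx k hk.le t h1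
  · rw [if_neg (fun h => h1 h.2), if_pos ⟨rfl, not_lt.1 h1, ht⟩]
    exact iterSt_ta_eq S hn hx hw k hk.le _ (by omega)

/-- **The explicit final state** under the semantic interface. [cite: Regev2004, Lemma 3.12 (proof, p. 14: the registers handed to the solver and the measured values)] -/
def finSt (P : Params) (S : SemHyp P) (L n : ℕ) (x : List Bool) (w : ℕ → Bool) : St where
  pre := fun i => decide (i = ell n - 1)
  slot := fun k t => decide (k < rmax P L ∧ t < slotW n ∧ S.Act L x (guessOf P L w) k) && tacOf P L w k t
  ix := fun _ => false
  ta := fun _ => false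
  x := x
  g := guessOf P L w
  zc := rmax P L
  wwork := fun _ => false
  wres := fun _ => false
  vwork := fun _ => false
  vres := fun _ => false
  tm := fun _ => false
  cz := fun _ _ => false
  gz := fun k t => readOut P.eW P.MW (n0W P L) (P.fW (wordW P L x (guessOf P L w) (ixcOf P L w k) (tacOf P L w k) k)) (NNW P L + t)
  gt := fun k t => !decide (S.Act L x (guessOf P L w) k) && tacOf P L w k t
  rest := w

/-- **The final wire assignment of the classical program is that of `finSt`.** [cite: Regev2004, Lemma 3.12 (proof, p. 14)] -/
theorem toWires_finalSt (S : SemHyp P) (hn : n ≤ L) (hx : x.length = L) (hw : IsInput P L n x w) :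
    toWires P L n (iterSt P L n (rmax P L) (initSt P L n x w)) = toWires P L n (finSt P S L n x w) := by
  have hc := offsets_chain (P := P) L
  set s := iterSt P L n (rmax P L) (initSt P L n x w) with hs
  have hinv : Inv n (rmax P L) s := inv_iterSt (inv_initSt L n x w) _
  obtain ⟨h1, h2, h3, h4⟩ := iterSt_const (P := P) (L := L) (n := n) (initSt P L n x w) (rmax P L)
  have hsw : slotW n ≤ sig L := by unfold sig slotW; have := ell_mono hn; omega
  have hcp := copyW_pos (P := P) L
  funext i
  refine toWires_eq_of s (finSt P S L n x w) (hpre := fun _ => by rw [h1]; rfl) (hwz := fun _ _ => by rw [h2]; rfl)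
    (hg := fun _ _ => by rw [h3]; rfl) (hrest := fun _ => by rw [h4]; rfl) (hZ := fun _ _ => by rw [hinv.zc]; rfl)
    (hwwork := fun _ _ => by rw [hinv.clean.wwork]; rfl) (hwres := fun _ _ => by rw [hinv.clean.wres]; rfl)
    (hvwork := fun _ _ => by rw [hinv.clean.vwork]; rfl) (hvres := fun _ _ => by rw [hinv.clean.vres]; rfl)
    (htm := fun _ _ => by rw [hinv.tm]; rfl)
    (hix := fun hlo hhi => ?_) (hta := fun hlo hhi => ?_) (hslot := fun hlo hhi => ?_) (hcz := fun hlo hhi => ?_)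
    (hgz := fun hlo hhi => ?_) (hgt := fun hlo hhi => ?_)
  · -- slots
    have hsw0 : 0 < slotW n := by unfold slotW; omega
    obtain ⟨heq, hlt⟩ := zone_eq_divMod (base := ell n) (w := slotW n) (i := i) hsw0 hlo
    have hk : (i - ell n) / slotW n < rmax P L := by
      by_contra hge
      have hm : rmax P L * slotW n ≤ (i - ell n) / slotW n * slotW n := Nat.mul_le_mul_right _ (not_lt.1 hge)
      omega
    rw [finalSt_slot (inv_initSt L n x w) hk hlt, iterSt_cz_of_le _ _ _ le_rfl, maskBit_preW S hn hx hk (by omega)]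
    change (tacOf P L w _ _ ^^ _) = (decide _ && _)
    simp only [hk, hlt, true_and]
    cases hta : tacOf P L w ((i - ell n) / slotW n) ((i - ell n) % slotW n) <;> by_cases ha : S.Act L x (guessOf P L w) ((i - ell n) / slotW n) <;> simp [ha]
  · exact iterSt_ix_eq S hn hx _ le_rfl _ (by omega)
  · exact iterSt_ta_eq S hn hx hw _ le_rfl _ (by omega)
  · -- coin zones
    have hcw0 : 0 < cW P L := by unfold cW sig slotW; omega
    obtain ⟨heq, hlt⟩ := zone_eq_divMod (base := cBase P L) (w := cW P L) (i := i) hcw0 hlo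
    have hk : (i - cBase P L) / cW P L < rmax P L := by
      by_contra hge
      have hm : rmax P L * cW P L ≤ (i - cBase P L) / cW P L * cW P L := Nat.mul_le_mul_right _ (not_lt.1 hge)
      omega
    exact finalSt_cz S hn hx hw hk hlt
  · -- garbage zones
    obtain ⟨heq, hlt⟩ := zone_eq_divMod (base := gBase P L) (w := copyW P L) (i := i) hcp hlo
    have hk : (i - gBase P L) / copyW P L < rmax P L := by
      by_contra hge
      have hm : rmax P L * copyW P L ≤ (i - gBase P L) / copyW P L * copyW P L := Nat.mul_le_mul_right _ (not_lt.1 hge)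
      omega
    rw [finalSt_gz hk]
    change rdW P L n (preW P L n x w _) _ = _
    unfold rdW
    rw [dW_preW hn]
    rfl
  · -- mask garbage zones
    have hsig : 0 < sig L := by unfold sig slotW; omega
    obtain ⟨heq, hlt⟩ := zone_eq_divMod (base := gtBase P L) (w := sig L) (i := i) hsig hlo
    have hk : (i - gtBase P L) / sig L < rmax P L := by
      by_contra hge
      have hm : rmax P L * sig L ≤ (i - gtBase P L) / sig L * sig L := Nat.mul_le_mul_right _ (not_lt.1 hge)
      omega
    rw [finalSt_gt (inv_initSt L n x w) hk]
    dsimp only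
    rw [maskBit_preW S hn hx hk hlt]
    change _ = (!decide _ && _)
    by_cases ha : S.Act L x (guessOf P L w) ((i - gtBase P L) / sig L) <;> simp [ha]

end Final

/-! ### Branches of the Hadamard layer are input assignments; the compiled program on them -/

section Branches

variable {L : ℕ} {x : List Bool}

/-- **A branch of the Hadamard layer**: a basis label agreeing with `|x⟩|0…0⟩` off the coin wires. [cite: NielsenChuang2010, §1.4.4] -/
def IsBranch (P : Params) (x : List Bool) (z : QReg (x.length + anc P x.length)) : Prop :=
  ∀ j, j ∉ coinFin P x.length → z j = padInput x.get (anc P x.length) j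

/-- The Hadamard state is `2^{-c/2}` on branches and `0` elsewhere. [folklore] -/
theorem stateH_eq (z : QReg (x.length + anc P x.length)) [Decidable (IsBranch P x z)] :
    stateH P x z = if IsBranch P x z then invSqrt2 ^ numCoins P x.length else 0 := by
  unfold stateH IsBranch; congr 1

/-- **Branches are input assignments** (lifted to `ℕ`-indexed wires). [folklore] -/
theorem isInput_liftW_of_isBranch {z : QReg (x.length + anc P x.length)} (hz : IsBranch P x z) :
    IsInput P x.length (nOf x.length) x (liftW z) where
  len := rfl
  inp := fun i hi => by
    have hc := offsets_chain (P := P) x.length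
    have hlt : i < x.length + anc P x.length := by rw [add_anc]; omega
    have hni : (⟨i, hlt⟩ : Fin _) ∉ coinFin P x.length := fun h => by
      rw [mem_coinFin_iff] at h
      have := (coinPos_bounds (nOf_le x.length) h).1
      simp at this; omega
    rw [show liftW z i = z ⟨i, hlt⟩ from by simp [liftW, hlt], hz _ hni]
    have := congrFun (CWrap.liftW_padInput_get x (anc P x.length)) i
    rw [show liftW (padInput x.get (anc P x.length)) i = padInput x.get (anc P x.length) ⟨i, hlt⟩ from by simp [liftW, hlt]] at this
    rw [this, strW]
  zero := fun i hi hni => by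
    by_cases hlt : i < x.length + anc P x.length
    · have hni' : (⟨i, hlt⟩ : Fin _) ∉ coinFin P x.length := fun h => by
        rw [mem_coinFin_iff] at h
        exact hni (coinWire_of_mem_coinPos h)
      rw [show liftW z i = z ⟨i, hlt⟩ from by simp [liftW, hlt], hz _ hni']
      have := congrFun (CWrap.liftW_padInput_get x (anc P x.length)) i
      rw [show liftW (padInput x.get (anc P x.length)) i = padInput x.get (anc P x.length) ⟨i, hlt⟩ from by simp [liftW, hlt]] at this
      rw [this, strW, List.getD_eq_default _ _ (by simpa using hi)]
    · simp [liftW, hlt]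

/-- **The compiled program on a branch computes the explicit final state** (under the semantic
interface). [cite: Regev2004, Lemma 3.12 (proof, p. 14)] -/
theorem liftW_kappa_of_isBranch (S : SemHyp P) {z : QReg (x.length + anc P x.length)} (hz : IsBranch P x z) :
    liftW (kappa P x.length z) = toWires P x.length (nOf x.length) (finSt P S x.length (nOf x.length) x (liftW z)) := by
  rw [liftW_kappa, prog_sem (nOf_le x.length) (isInput_liftW_of_isBranch hz), toWires_finalSt S (nOf_le x.length) rfl
    (isInput_liftW_of_isBranch hz)]

/-- The wires of `kappa z` on a branch, read off `finSt`. [folklore] -/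
theorem kappa_apply_of_isBranch (S : SemHyp P) {z : QReg (x.length + anc P x.length)} (hz : IsBranch P x z)
    (p : Fin (x.length + anc P x.length)) :
    kappa P x.length z p = toWires P x.length (nOf x.length) (finSt P S x.length (nOf x.length) x (liftW z)) p := by
  rw [← liftW_val (kappa P x.length z) p, liftW_kappa_of_isBranch S hz]

end Branches

end RegevRoutine

end Literature.Algebra.EuclideanLattices

end
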